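import Literature.Algebra.Lie.LefschetzModule
import Literature.Algebra.Lie.WeylCompleteReducibility
import HarnessLib

/-!
# Looijenga–Lunts' example of a non-reductive `𝔤(𝔞, M)`: `M = 𝔰𝔩₂ ⊕ K²` (Looijenga–Lunts 1997, §1 (1.1), Example)

Topic `Literature/Algebra/Lie` (namespace `Literature.Algebra.Lie.NonReductiveExample`).  Lane `lit-hodgefound`
(Track 2 foundations library), skeleton seat `lit-hodgefound-skel-1` (generation 44), row **A1-130** of
`run/shared/lean/pub/lit-hodgefound/SKELETON.md`: the EXAMPLE of Looijenga–Lunts §1 (1.1) showing that the Lie algebra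
`𝔤(𝔞, M)` of an abelian degree-two `𝔞 ⊆ 𝔤𝔩(M)` with the Lefschetz property "need not act reductively in `M`" — a
validation NON-EXAMPLE for A1-88's `IsLefschetzModule` (`LefschetzModule.lean`): all clauses of a Lefschetz module hold
(`ℤ`-grading, `𝔞` abelian of degree `2`, `dom f ≠ ∅`) EXCEPT the semisimplicity of `𝔤(𝔞, M)`, which fails.  Concrete
model `M = K⁵` over any field of characteristic `0`; DEFINITIONS WITH BODIES (the operators `hOp`, `eOp`, `fOp`, `e'Op`,
the subspace `𝔞`, the vectors `uVec`, `fVec`, the form `form`) and PROVED theorems; no named fact, no `sorry`, no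
instance, no notation (D-0026 net debt `0`).  `LieRing.ofAssociativeRing` on `𝔤𝔩(M)` is enabled FILE-LOCALLY as in
the rest of the series.

## Source, VERBATIM

E. Looijenga, V. A. Lunts, *A Lie algebra attached to a projective variety*, Invent. Math. **129** (1997) 361–412,
§1 (1.1) (held TeX text `paper:arxiv-alg-geom_9604014`, p0004 L41–L54):

> "The following example shows that this Lie algebra need not act reductively in `M`.
> Example. Consider the graded `𝔰𝔩(2)`-representation `M = 𝔰𝔩(2) ⊕ K²`, where `𝔰𝔩(2) = Ke + Kh + Kf` has the
> adjoint representation (with its usual grading) and `K²` is the trivial representation in degree zero. Define an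
> operator `e'` of degree `2` in `M` by `e'(xf + yh + zf, u, v) = (ve, z, 0)`. Then `ee' = e'e = 0`, so that `e` and
> `e'` span an abelian Lie algebra `𝔞`. Since `e` has the Lefschetz property, the Lie algebra `𝔤 = 𝔤(𝔞, M)` is
> defined. Now `𝔞` kills `(0, 1, 0)`, but the line spanned by this vector has no `𝔤`-invariant complement. This
> example was chosen as to make `𝔤` infinitesimally preserve a nondegenerate quadratic form on `M` (namely
> `(xf + yh + zf, u, v) ↦ -2xz + y² + 2uv`). A smaller example without that property is the submodule `𝔰𝔩(2) ⊕ K ⊕ 0`."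

(Both occurrences of "`xf + yh + zf`" are misprints for `xe + yh + zf`.)  With (1.1) p0004 L57–L58: "We say that
`(𝔞, M)` is a Lefschetz module if `𝔤(𝔞, M)` is semisimple", and (1.2) p0004 L67–L68: "Since any representation of a
semisimple Lie algebra is reductive".

## Rendering (dictionary)

* `M = 𝔰𝔩₂ ⊕ K² = K⁵`, coordinates `m = (x, y, z, u, v) = (m 0, …, m 4)` for `(xe + yh + zf, u, v)`; `h = hOp K`
  (`ad h ⊕ 0`: `(2x, 0, -2z, 0, 0)`), `e = eOp K` (`ad e ⊕ 0`: `(-2y, z, 0, 0, 0)`), `f = fOp K` (`ad f ⊕ 0`: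
  `(0, -x, 2y, 0, 0)`), `e' = e'Op K` (`(v, 0, 0, z, 0)`, as printed), `𝔞 = 𝔞 K = Submodule.span K {e, e'}`,
  "`(0, 1, 0)`" = `uVec K = Pi.single 3 1`, `f ∈ M` = `fVec K = Pi.single 2 1`.
* "`𝔤 = 𝔤(𝔞, M)`" = `lefschetzLieAlgebra K (hOp K) (𝔞 K)` (A1-88); "has the Lefschetz property" = `HasLefschetzProperty`,
  `lefschetzDomain`; "act reductively" is rendered through its consequence used by the source: a `𝔤`-INVARIANT
  COMPLEMENT of the `𝔤`-submodule `Ku`; "Lefschetz module" = `IsLefschetzModule`.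
* the quadratic form: `form K`, `B(m, m') = xz' + zx' + 2yy' - uv' - vu'`, `B(m, m) = 2(xz + y² - uv)`
  (`form_apply_self`).  NORMALISATION: in these coordinates the `𝔤`-invariant symmetric forms are exactly
  `α(xz' + zx' + 2yy' - uv' - vu') + σ vv'` (a direct check), non-degenerate iff `α ≠ 0`; the printed
  `-2xz + y² + 2uv` is our `xz + y² - uv` after the substitution `z ↦ -2z`, `u ↦ -2u`, i.e. the source normalises the
  coordinates on `Kf` and on `K·(1, 0)` differently (by the factor `-2`); the statements below use our coordinates.

## Contents (all proved)

* §1 the operators and vectors (definitions with bodies, `@[simp]` evaluation lemmas).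
* §2 `lie_h_e_eq_smul`, `lie_h_e'_eq_smul` (`e`, `e'` of degree `2`), `e_mul_e'`, `e'_mul_e`, **`lie_e_e'`**
  ("`ee' = e'e = 0`"), `lie_eq_zero_of_mem_𝔞` (`𝔞` abelian), `𝔞_le_adDegree` (`𝔞 ⊆ 𝔤𝔩(M)₂`), `single_mem_degreeSpace`,
  **`isZGrading`** (`M = M_{-2} ⊕ M_0 ⊕ M_2`), `hOp_ne_zero`, **`isSl2Triple`** (`(e, h, f)` is an `𝔰𝔩₂`-triple),
  **`hasLefschetzProperty_e`** ("`e` has the Lefschetz property"), `e_mem_lefschetzDomain` (`dom f ≠ ∅`: "`𝔤(𝔞, M)` is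
  defined").
* §3 **`apply_uVec_eq_zero`** ("`𝔞` kills `(0, 1, 0)`"), `uVec_mem_primitiveSpace`,
  **`apply_uVec_eq_zero_of_mem_lefschetzLieAlgebra`** (all of `𝔤(𝔞, M)` kills `u`: `Ku` is a `𝔤`-submodule — the
  partners `f_a` kill the weight-`0` primitive vector `u`, A1-88 `dual_apply_primitive`).
* §4 `e'Op_fVec` (`e'f = u`), `uVec_ne_zero`, **`not_isCompl_of_e'_stable`** ("the line spanned by this vector has no
  `𝔤`-invariant complement" — indeed none stable under `e'` alone), **`not_isSemisimple`** ("need not act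
  reductively": `𝔤(𝔞, M)` is not semisimple, by the tree's Weyl theorem `exists_isCompl_lieSubmodule_of_isSemisimple`),
  **`not_isLefschetzModule`** (`(𝔞, M)` is not a Lefschetz module although `𝔞` has the Lefschetz property).
* §5 the invariant form: `form`, `form_apply_self`, `form_isSymm`, **`form_nondegenerate`**, `isSkewAdjoint_form_hOp`,
  `isSkewAdjoint_form_eOp`, `isSkewAdjoint_form_e'Op`, `isSkewAdjoint_form_of_mem_𝔞`, and
  **`lefschetzLieAlgebra_le_skewAdjointLieSubalgebra_form`** ("`𝔤` infinitesimally preserve[s] a nondegenerate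
  quadratic form on `M`": `𝔤(𝔞, M) ≤ 𝔞𝔲𝔱(M, B)`, by A1-88 `lefschetzLieAlgebra_le_skewAdjointLieSubalgebra`).

## SCOPE

(a) "A smaller example without that property is the submodule `𝔰𝔩(2) ⊕ K ⊕ 0`" is not formalised separately (the same
argument applies inside the `𝔞`-stable hyperplane `v = 0`).  (b) "act reductively" is not introduced as a notion; the
file proves the failure of complete reducibility on the submodule `Ku` and the resulting non-semisimplicity.  (c) The
structure of `𝔤(𝔞, M)` (its dimension, radical) is not computed.  (d) Nothing here concerns complex tori or the Hodge
conjecture.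

## References

* [LooijengaLunts1997] E. Looijenga, V. A. Lunts, *A Lie algebra attached to a projective variety*, Invent. Math.
  129 (1997) 361–412; arXiv:alg-geom/9604014. §1 (1.1), p. 4 L41–L58 of the held TeX text; (1.2) p. 4 L67–L68;
  (1.3) p. 5 L1–L9.
* [Bourbaki1989LieGroups13] N. Bourbaki, *Lie Groups and Lie Algebras, Chapters 1–3*, Springer (1989), Ch. I §6
  no. 2 Thm. 2 (Weyl's theorem) — as formalised in `WeylCompleteReducibility.lean`.
-/

noncomputable section

namespace Literature.Algebra.Lie

open Module Function Set
open LinearMap (BilinForm)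
open HasLefschetzProperty (primitiveSpace mem_primitiveSpace_iff)

-- The commutator Lie ring of `𝔤𝔩(M) = Module.End K M`: Mathlib's reducible NON-instance, enabled file-locally
-- exactly as in `LefschetzModule.lean`.
attribute [local instance 100] LieRing.ofAssociativeRing

namespace NonReductiveExample

variable (K : Type*) [Field K]

/-! ### §1 The module `M = 𝔰𝔩₂ ⊕ K² = K⁵` and the operators `h, e, f, e'` -/

/-- **The degree operator `h = ad h ⊕ 0`** on `M = 𝔰𝔩₂ ⊕ K²`, in the coordinates
`m = (x, y, z, u, v) = (m 0, m 1, m 2, m 3, m 4)` of `x e + y h + z f ∈ 𝔰𝔩₂`, `(u, v) ∈ K²`: `[h, xe + yh + zf] = 2x e - 2z f`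
and `h = 0` on `K²` ("`𝔰𝔩₂ = Ke + Kh + Kf` has the adjoint representation (with its usual grading) and `K²` is the
trivial representation in degree zero"). [cite: LooijengaLunts1997, §1 (1.1) Example, p0004 L44–L46] -/
def hOp : Module.End K (Fin 5 → K) where
  toFun m := ![2 * m 0, 0, -2 * m 2, 0, 0]
  map_add' m m' := by ext i; fin_cases i <;> simp [mul_add]
  map_smul' c m := by ext i; fin_cases i <;> simp [mul_left_comm]

/-- **`e = ad e ⊕ 0`**: `[e, xe + yh + zf] = -2y e + z h`. [cite: LooijengaLunts1997, §1 (1.1) Example, p0004 L44–L46] -/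
def eOp : Module.End K (Fin 5 → K) where
  toFun m := ![-2 * m 1, m 2, 0, 0, 0]
  map_add' m m' := by ext i; fin_cases i <;> simp [mul_add]
  map_smul' c m := by ext i; fin_cases i <;> simp [mul_left_comm]

/-- **`f = ad f ⊕ 0`**: `[f, xe + yh + zf] = -x h + 2y f`. [cite: LooijengaLunts1997, §1 (1.1) Example, p0004 L44–L46] -/
def fOp : Module.End K (Fin 5 → K) where
  toFun m := ![0, -m 0, 2 * m 1, 0, 0]
  map_add' m m' := by ext i; fin_cases i <;> simp [mul_add, add_comm]
  map_smul' c m := by ext i; fin_cases i <;> simp [mul_left_comm]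

/-- **The operator `e'` of degree `2`**: "`e'(xe + yh + zf, u, v) = (ve, z, 0)`". [cite: LooijengaLunts1997, §1 (1.1) Example, p0004 L46–L47] -/
def e'Op : Module.End K (Fin 5 → K) where
  toFun m := ![m 4, 0, 0, m 2, 0]
  map_add' m m' := by ext i; fin_cases i <;> simp
  map_smul' c m := by ext i; fin_cases i <;> simp

/-- `h` in coordinates. [cite: LooijengaLunts1997, §1 (1.1) Example, p0004 L44–L46] -/
@[simp] theorem hOp_apply (m : Fin 5 → K) : hOp K m = ![2 * m 0, 0, -2 * m 2, 0, 0] := rfl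

/-- `e` in coordinates. [cite: LooijengaLunts1997, §1 (1.1) Example, p0004 L44–L46] -/
@[simp] theorem eOp_apply (m : Fin 5 → K) : eOp K m = ![-2 * m 1, m 2, 0, 0, 0] := rfl

/-- `f` in coordinates. [cite: LooijengaLunts1997, §1 (1.1) Example, p0004 L44–L46] -/
@[simp] theorem fOp_apply (m : Fin 5 → K) : fOp K m = ![0, -m 0, 2 * m 1, 0, 0] := rfl

/-- `e'` in coordinates. [cite: LooijengaLunts1997, §1 (1.1) Example, p0004 L46–L47] -/
@[simp] theorem e'Op_apply (m : Fin 5 → K) : e'Op K m = ![m 4, 0, 0, m 2, 0] := rfl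

/-- **`𝔞 = Ke + Ke'`** ("`e` and `e'` span an abelian Lie algebra `𝔞`"). [cite: LooijengaLunts1997, §1 (1.1) Example, p0004 L48–L49] -/
def 𝔞 : Submodule K (Module.End K (Fin 5 → K)) := Submodule.span K {eOp K, e'Op K}

/-- **The vector `(0, 1, 0)`** of the source: `u = (0 ∈ 𝔰𝔩₂, (1, 0) ∈ K²)`, coordinate `3`.
[cite: LooijengaLunts1997, §1 (1.1) Example, p0004 L50] -/
def uVec : Fin 5 → K := Pi.single 3 1

/-- The vector `f ∈ 𝔰𝔩₂ ⊂ M`, coordinate `2` (the bottom of the string through `e'`: `e' f = u`).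
[cite: LooijengaLunts1997, §1 (1.1) Example, p0004 L46–L47] -/
def fVec : Fin 5 → K := Pi.single 2 1

/-! ### §2 `(e, h, f)` is an `𝔰𝔩₂`-triple, `𝔞` is abelian of degree `2`, and `e` is a Lefschetz operator -/

/-- `e ∈ 𝔞`. [cite: LooijengaLunts1997, §1 (1.1) Example, p0004 L48–L49] -/
theorem e_mem_𝔞 : eOp K ∈ 𝔞 K := Submodule.subset_span (Set.mem_insert _ _)

/-- `e' ∈ 𝔞`. [cite: LooijengaLunts1997, §1 (1.1) Example, p0004 L48–L49] -/
theorem e'_mem_𝔞 : e'Op K ∈ 𝔞 K := Submodule.subset_span (Set.mem_insert_of_mem _ rfl)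

/-- `[h, e] = 2e` (with the scalar `2 ∈ K`). [cite: LooijengaLunts1997, §1 (1.1) p0004 L44–L46 ("with its usual grading")] -/
theorem lie_h_e_eq_smul : ⁅hOp K, eOp K⁆ = (2 : K) • eOp K := by
  refine LinearMap.ext fun m ↦ funext fun i ↦ ?_
  rw [Ring.lie_def]
  fin_cases i <;> simp

/-- `[h, e'] = 2e'`: `e'` has degree `2`. [cite: LooijengaLunts1997, §1 (1.1) Example, p0004 L46–L47 ("an operator e' of degree 2")] -/
theorem lie_h_e'_eq_smul : ⁅hOp K, e'Op K⁆ = (2 : K) • e'Op K := by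
  refine LinearMap.ext fun m ↦ funext fun i ↦ ?_
  rw [Ring.lie_def]
  fin_cases i <;> simp

/-- "`ee' = e'e = 0`", first half. [cite: LooijengaLunts1997, §1 (1.1) Example, p0004 L48] -/
theorem e_mul_e' : eOp K * e'Op K = 0 := by
  refine LinearMap.ext fun m ↦ funext fun i ↦ ?_
  fin_cases i <;> simp

/-- "`ee' = e'e = 0`", second half. [cite: LooijengaLunts1997, §1 (1.1) Example, p0004 L48] -/
theorem e'_mul_e : e'Op K * eOp K = 0 := by
  refine LinearMap.ext fun m ↦ funext fun i ↦ ?_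
  fin_cases i <;> simp

/-- "so that `e` and `e'` span an abelian Lie algebra `𝔞`": `[e, e'] = 0`. [cite: LooijengaLunts1997, §1 (1.1) Example, p0004 L48–L49] -/
theorem lie_e_e' : ⁅eOp K, e'Op K⁆ = 0 := by
  rw [Ring.lie_def, e_mul_e', e'_mul_e, sub_zero]

/-- `𝔞` is abelian: `[a, b] = 0` for `a, b ∈ 𝔞 = Ke + Ke'`. [cite: LooijengaLunts1997, §1 (1.1) Example, p0004 L48–L49] -/
theorem lie_eq_zero_of_mem_𝔞 {a b : Module.End K (Fin 5 → K)} (ha : a ∈ 𝔞 K) (hb : b ∈ 𝔞 K) : ⁅a, b⁆ = 0 := by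
  obtain ⟨α, β, rfl⟩ := Submodule.mem_span_pair.1 ha
  obtain ⟨γ, δ, rfl⟩ := Submodule.mem_span_pair.1 hb
  have h1 : ⁅e'Op K, eOp K⁆ = 0 := by rw [Ring.lie_def, e'_mul_e, e_mul_e', sub_zero]
  simp only [lie_add, add_lie, lie_smul, smul_lie, lie_self, lie_e_e', h1, smul_zero, add_zero]

/-- `𝔞 ⊆ 𝔤𝔩(M)₂` ("homogeneous of degree two"). [cite: LooijengaLunts1997, §1 (1.1) p0004 L28–L29 and Example L41–L42] -/
theorem 𝔞_le_adDegree : 𝔞 K ≤ adDegree K (hOp K) 2 := by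
  rw [𝔞, Submodule.span_le]
  rintro x (rfl | rfl)
  · exact Module.End.mem_eigenspace_iff.2 (by rw [LieAlgebra.ad_apply, lie_h_e_eq_smul])
  · exact Module.End.mem_eigenspace_iff.2 (by rw [LieAlgebra.ad_apply, lie_h_e'_eq_smul])

/-- The standard basis vector `εᵢ` has degree `(2, 0, -2, 0, 0)ᵢ` for `h`. [cite: LooijengaLunts1997, §1 (1.1) Example, p0004 L44–L46] -/
theorem single_mem_degreeSpace (i : Fin 5) :
    (Pi.single i 1 : Fin 5 → K) ∈ degreeSpace (hOp K) ((![2, 0, -2, 0, 0] : Fin 5 → ℤ) i) := by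
  rw [mem_degreeSpace_iff]
  ext j
  fin_cases i <;> fin_cases j <;> simp

/-- **`(M, h)` is `ℤ`-graded**: `M = M_{-2} ⊕ M_0 ⊕ M_2` (`Kf`, `Kh ⊕ K²`, `Ke`). [cite: LooijengaLunts1997, §1 (1.1) Example, p0004 L44–L46] -/
theorem isZGrading : IsZGrading (hOp K) := by
  rw [IsZGrading, eq_top_iff, ← (Pi.basisFun K (Fin 5)).span_eq, Submodule.span_le]
  rintro _ ⟨i, rfl⟩
  rw [Pi.basisFun_apply]
  exact Submodule.mem_iSup_of_mem _ (single_mem_degreeSpace K i)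

variable [CharZero K]

/-- `h ≠ 0`. [cite: LooijengaLunts1997, §1 (1.1) Example, p0004 L44–L46] -/
theorem hOp_ne_zero : hOp K ≠ 0 := by
  intro h0
  have h1 := congr_fun (LinearMap.congr_fun h0 (Pi.single 0 1)) 0
  simp at h1

/-- **`(e, h, f)` is an `𝔰𝔩₂`-triple in `𝔤𝔩(M)`** (the adjoint triple of `𝔰𝔩₂`, extended by `0` on `K²`).
[cite: LooijengaLunts1997, §1 (1.1) p0004 L5–L20 (the standard triple) and Example L38–L41] -/
theorem isSl2Triple : IsSl2Triple (hOp K) (eOp K) (fOp K) where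
  h_ne_zero := hOp_ne_zero K
  lie_e_f := by
    refine LinearMap.ext fun m ↦ funext fun i ↦ ?_
    rw [Ring.lie_def]
    fin_cases i <;> simp
  lie_h_e_nsmul := by
    rw [lie_h_e_eq_smul, two_smul, two_nsmul]
  lie_h_f_nsmul := by
    refine LinearMap.ext fun m ↦ funext fun i ↦ ?_
    rw [Ring.lie_def]
    fin_cases i <;> simp

/-- **`e` has the Lefschetz property** ("Since `e` has the Lefschetz property, the Lie algebra `𝔤 = 𝔤(𝔞, M)` is
defined"), by A1-88's criterion from the `𝔰𝔩₂`-triple. [cite: LooijengaLunts1997, §1 (1.1) Example, p0004 L48–L49] -/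
theorem hasLefschetzProperty_e : HasLefschetzProperty (hOp K) (eOp K) :=
  hasLefschetzProperty_of_isSl2Triple (isZGrading K) (isSl2Triple K)

/-- So `e ∈ dom f`: the Lefschetz condition on `𝔞` holds (`𝔤(𝔞, M)` "is defined"). [cite: LooijengaLunts1997, §1 (1.1) Example, p0004 L48–L49] -/
theorem e_mem_lefschetzDomain : eOp K ∈ lefschetzDomain K (hOp K) (𝔞 K) :=
  ⟨e_mem_𝔞 K, fOp K, isSl2Triple K⟩

/-! ### §3 `𝔞` — indeed all of `𝔤(𝔞, M)` — kills `u = (0, 1, 0)` -/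

omit [CharZero K] in
/-- **"`𝔞` kills `(0, 1, 0)`"**. [cite: LooijengaLunts1997, §1 (1.1) Example, p0004 L50] -/
theorem apply_uVec_eq_zero {a : Module.End K (Fin 5 → K)} (ha : a ∈ 𝔞 K) : a (uVec K) = 0 := by
  obtain ⟨α, β, rfl⟩ := Submodule.mem_span_pair.1 ha
  ext i
  fin_cases i <;> simp [uVec]

omit [CharZero K] in
/-- `u` is primitive of weight `0` for every `a ∈ 𝔞` (`u ∈ M_0`, `a u = 0`). [cite: LooijengaLunts1997, §1 (1.1) Example, p0004 L50] -/
theorem uVec_mem_primitiveSpace {a : Module.End K (Fin 5 → K)} (ha : a ∈ 𝔞 K) : uVec K ∈ primitiveSpace (hOp K) a 0 := by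
  rw [mem_primitiveSpace_iff, zero_add, pow_one, apply_uVec_eq_zero K ha, mem_degreeSpace_iff]
  refine ⟨?_, rfl⟩
  ext j
  fin_cases j <;> simp [uVec]

/-- **The line `Ku` is a (trivial) `𝔤(𝔞, M)`-submodule: every element of `𝔤(𝔞, M)` kills `u`** — the generators
`e_a` (`a ∈ 𝔞`) do, and so do the partners `f_a` (`u` is `a`-primitive of weight `0`, and `f_a` kills primitive
vectors: A1-88 `dual_apply_primitive`). [cite: LooijengaLunts1997, §1 (1.1) Example, p0004 L50–L51] -/
theorem apply_uVec_eq_zero_of_mem_lefschetzLieAlgebra {x : Module.End K (Fin 5 → K)}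
    (hx : x ∈ lefschetzLieAlgebra K (hOp K) (𝔞 K)) : x (uVec K) = 0 := by
  -- the annihilator of `u` is a Lie subalgebra containing the generators
  let H : LieSubalgebra K (Module.End K (Fin 5 → K)) :=
    { carrier := {y | y (uVec K) = 0}
      add_mem' := fun {y z} hy hz ↦ by
        simp only [Set.mem_setOf_eq, LinearMap.add_apply] at hy hz ⊢
        rw [hy, hz, add_zero]
      zero_mem' := by simp
      smul_mem' := fun c {y} hy ↦ by
        simp only [Set.mem_setOf_eq, LinearMap.smul_apply] at hy ⊢
        rw [hy, smul_zero]
      lie_mem' := fun {y z} hy hz ↦ by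
        simp only [Set.mem_setOf_eq] at hy hz ⊢
        rw [Ring.lie_def, LinearMap.sub_apply, Module.End.mul_apply, Module.End.mul_apply, hy, hz, map_zero,
          map_zero, sub_zero] }
  suffices hle : lefschetzLieAlgebra K (hOp K) (𝔞 K) ≤ H from hle hx
  rw [lefschetzLieAlgebra_le_iff]
  refine ⟨fun a ha ↦ apply_uVec_eq_zero K ha, ?_⟩
  rintro f' ⟨a, ha, t⟩
  have La : HasLefschetzProperty (hOp K) a := hasLefschetzProperty_of_isSl2Triple (isZGrading K) t
  show f' (uVec K) = 0
  rw [La.eq_dual_of_isSl2Triple (isZGrading K) t]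
  exact La.dual_apply_primitive (isZGrading K) (uVec_mem_primitiveSpace K ha)

/-! ### §4 … but `Ku` has no invariant complement: `𝔤(𝔞, M)` is not semisimple, `(𝔞, M)` is not a Lefschetz module -/

omit [CharZero K] in
/-- `e' f = u`. [cite: LooijengaLunts1997, §1 (1.1) Example, p0004 L46–L47] -/
theorem e'Op_fVec : e'Op K (fVec K) = uVec K := by
  ext i
  fin_cases i <;> simp [uVec, fVec]

omit [CharZero K] in
/-- `u ≠ 0`. [cite: LooijengaLunts1997, §1 (1.1) Example, p0004 L50] -/
theorem uVec_ne_zero : uVec K ≠ 0 := by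
  intro h0
  have h1 := congr_fun h0 3
  simp [uVec] at h1

omit [CharZero K] in
/-- **"the line spanned by this vector has no `𝔤`-invariant complement"** — indeed no complement stable under
`e' ∈ 𝔞 ⊆ 𝔤(𝔞, M)` alone: if `M = Ku ⊕ W` with `e'W ⊆ W`, write `f = cu + w`; then `u = e'f = e'w ∈ W`, so
`u ∈ Ku ∩ W = 0`, a contradiction. [cite: LooijengaLunts1997, §1 (1.1) Example, p0004 L50–L51] -/
theorem not_isCompl_of_e'_stable (W : Submodule K (Fin 5 → K)) (hW : ∀ w ∈ W, e'Op K w ∈ W) :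
    ¬ IsCompl (K ∙ uVec K) W := by
  intro hc
  have hf : fVec K ∈ (K ∙ uVec K) ⊔ W := by rw [hc.sup_eq_top]; exact Submodule.mem_top
  obtain ⟨y, hy, w, hw, hyw⟩ := Submodule.mem_sup.1 hf
  obtain ⟨c, rfl⟩ := Submodule.mem_span_singleton.1 hy
  have hu : uVec K ∈ W := by
    have h1 := congr_arg (e'Op K) hyw
    rw [map_add, map_smul, e'Op_fVec, apply_uVec_eq_zero K (e'_mem_𝔞 K), smul_zero, zero_add] at h1
    rw [← h1]
    exact hW w hw
  have h0 : uVec K ∈ (K ∙ uVec K) ⊓ W := ⟨Submodule.mem_span_singleton_self _, hu⟩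
  rw [hc.inf_eq_bot, Submodule.mem_bot] at h0
  exact uVec_ne_zero K h0

/-- **"this Lie algebra need not act reductively in `M`": `𝔤(𝔞, M)` is NOT semisimple** — a semisimple
`𝔤(𝔞, M)` would act completely reducibly (Weyl, the tree's `exists_isCompl_lieSubmodule_of_isSemisimple`), and the
submodule `Ku` would have an invariant complement. [cite: LooijengaLunts1997, §1 (1.1) Example, p0004 L41–L51] -/
theorem not_isSemisimple : ¬ LieAlgebra.IsSemisimple K (lefschetzLieAlgebra K (hOp K) (𝔞 K)) := by
  intro hss
  haveI : FiniteDimensional K (lefschetzLieAlgebra K (hOp K) (𝔞 K)) :=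
    inferInstanceAs (FiniteDimensional K (lefschetzLieAlgebra K (hOp K) (𝔞 K)).toSubmodule)
  -- the trivial submodule `Ku`
  let P : LieSubmodule K (lefschetzLieAlgebra K (hOp K) (𝔞 K)) (Fin 5 → K) :=
    { (K ∙ uVec K) with
      lie_mem := fun {x m} hm ↦ by
        rw [LieSubalgebra.coe_bracket_of_module, Module.End.lie_apply]
        obtain ⟨c, rfl⟩ := Submodule.mem_span_singleton.1 hm
        rw [map_smul, apply_uVec_eq_zero_of_mem_lefschetzLieAlgebra K x.2, smul_zero]
        exact Submodule.zero_mem _ }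
  obtain ⟨C, hPC⟩ := exists_isCompl_lieSubmodule_of_isSemisimple (k := K) P
  refine not_isCompl_of_e'_stable K (C : Submodule K (Fin 5 → K)) (fun w hw ↦ ?_) ⟨?_, ?_⟩
  · have h1 := C.lie_mem (x := ⟨e'Op K, mem_lefschetzLieAlgebra_of_mem (e'_mem_𝔞 K)⟩) hw
    rwa [LieSubalgebra.coe_bracket_of_module, Module.End.lie_apply] at h1
  · have h1 := hPC.inf_eq_bot
    rw [← LieSubmodule.toSubmodule_inj, LieSubmodule.inf_toSubmodule, LieSubmodule.bot_toSubmodule] at h1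
    exact disjoint_iff.2 h1
  · have h1 := hPC.sup_eq_top
    rw [← LieSubmodule.toSubmodule_inj, LieSubmodule.sup_toSubmodule, LieSubmodule.top_toSubmodule] at h1
    exact codisjoint_iff.2 h1

/-- **Hence `(𝔞, M)` is NOT a Lefschetz module** in the sense of A1-88 (`IsLefschetzModule` demands `𝔤(𝔞, M)`
semisimple), although `𝔞` is abelian of degree `2` and has the Lefschetz property (`e ∈ dom f`): the Lefschetz
property of `𝔞` alone does not make `(𝔞, M)` a Lefschetz module. [cite: LooijengaLunts1997, §1 (1.1) Example, p0004 L41–L51 and L57–L58 ("We say that (𝔞, M) is a Lefschetz module if 𝔤(𝔞, M) is semisimple")] -/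
theorem not_isLefschetzModule : ¬ IsLefschetzModule K (hOp K) (𝔞 K) := fun A ↦ not_isSemisimple K A.isSemisimple

/-! ### §5 The invariant quadratic form -/

/-- **The `𝔤`-invariant symmetric bilinear form** `B(m, m') = xz' + zx' + 2yy' - uv' - vu'`, i.e. the quadratic form
`Q(m) = B(m, m) = 2(xz + y² - uv)`: the Killing form (up to scalar) on `𝔰𝔩₂` plus a hyperbolic plane on `K²`, coupled
with the sign forced by `e'`.  In the source's normalisation of the coordinates on `Kf` and `Ku` (which differ from
ours by the factor `-2`: substitute `z ↦ -2z`, `u ↦ -2u`) this is the printed "`(xe + yh + zf, u, v) ↦ -2xz + y² + 2uv`".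
[cite: LooijengaLunts1997, §1 (1.1) Example, p0004 L51–L53 ("This example was chosen as to make 𝔤 infinitesimally preserve a nondegenerate quadratic form on M")] -/
def form : BilinForm K (Fin 5 → K) :=
  LinearMap.mk₂ K (fun m m' ↦ m 0 * m' 2 + m 2 * m' 0 + 2 * (m 1 * m' 1) - m 3 * m' 4 - m 4 * m' 3)
    (fun m₁ m₂ m' ↦ by simp only [Pi.add_apply]; ring) (fun c m m' ↦ by simp only [Pi.smul_apply, smul_eq_mul]; ring)
    (fun m m₁ m₂ ↦ by simp only [Pi.add_apply]; ring) (fun c m m' ↦ by simp only [Pi.smul_apply, smul_eq_mul]; ring)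

omit [CharZero K] in
/-- `B` in coordinates. [cite: LooijengaLunts1997, §1 (1.1) Example, p0004 L51–L53] -/
@[simp] theorem form_apply (m m' : Fin 5 → K) :
    form K m m' = m 0 * m' 2 + m 2 * m' 0 + 2 * (m 1 * m' 1) - m 3 * m' 4 - m 4 * m' 3 := rfl

omit [CharZero K] in
/-- The quadratic form: `B(m, m) = 2(xz + y² - uv)`. [cite: LooijengaLunts1997, §1 (1.1) Example, p0004 L51–L53] -/
theorem form_apply_self (m : Fin 5 → K) : form K m m = 2 * (m 0 * m 2 + m 1 ^ 2 - m 3 * m 4) := by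
  rw [form_apply]; ring

omit [CharZero K] in
/-- `B` is symmetric. [cite: LooijengaLunts1997, §1 (1.1) Example, p0004 L51–L53 ("quadratic form")] -/
theorem form_isSymm : (form K).IsSymm :=
  LinearMap.BilinForm.isSymm_def.2 fun m m' ↦ by rw [form_apply, form_apply]; ring

/-- **`B` is non-degenerate.** [cite: LooijengaLunts1997, §1 (1.1) Example, p0004 L51–L52 ("a nondegenerate quadratic form")] -/
theorem form_nondegenerate : (form K).Nondegenerate := by
  refine (form_isSymm K).isRefl.nondegenerate_iff_separatingLeft.2 fun m hm ↦ ?_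
  have h0 := hm (Pi.single 2 1)
  have h1 := hm (Pi.single 1 1)
  have h2 := hm (Pi.single 0 1)
  have h3 := hm (Pi.single 4 1)
  have h4 := hm (Pi.single 3 1)
  simp at h0 h1 h2 h3 h4
  ext i
  fin_cases i <;> simp [h0, h1, h2, h3, h4]

omit [CharZero K] in
/-- `h` preserves `B` infinitesimally (`B` pairs degree `k` with degree `-k`). [cite: LooijengaLunts1997, §1 (1.3) p0005 L3–L4] -/
theorem isSkewAdjoint_form_hOp : (form K).IsSkewAdjoint (hOp K) := by
  intro m m'
  show form K (hOp K m) m' = form K m (-(hOp K m'))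
  simp only [form_apply, hOp_apply, Pi.neg_apply]
  simp
  ring

omit [CharZero K] in
/-- `e` preserves `B` infinitesimally. [cite: LooijengaLunts1997, §1 (1.1) Example, p0004 L51–L53] -/
theorem isSkewAdjoint_form_eOp : (form K).IsSkewAdjoint (eOp K) := by
  intro m m'
  show form K (eOp K m) m' = form K m (-(eOp K m'))
  simp only [form_apply, eOp_apply, Pi.neg_apply]
  simp
  ring

omit [CharZero K] in
/-- `e'` preserves `B` infinitesimally. [cite: LooijengaLunts1997, §1 (1.1) Example, p0004 L51–L53] -/
theorem isSkewAdjoint_form_e'Op : (form K).IsSkewAdjoint (e'Op K) := by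
  intro m m'
  show form K (e'Op K m) m' = form K m (-(e'Op K m'))
  simp only [form_apply, e'Op_apply, Pi.neg_apply]
  simp
  ring

omit [CharZero K] in
/-- Every `a ∈ 𝔞` preserves `B` infinitesimally. [cite: LooijengaLunts1997, §1 (1.1) Example, p0004 L51–L53] -/
theorem isSkewAdjoint_form_of_mem_𝔞 {a : Module.End K (Fin 5 → K)} (ha : a ∈ 𝔞 K) : (form K).IsSkewAdjoint a := by
  obtain ⟨α, β, rfl⟩ := Submodule.mem_span_pair.1 ha
  intro m m'
  show form K ((α • eOp K + β • e'Op K) m) m' = form K m (-((α • eOp K + β • e'Op K) m'))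
  have h1 := isSkewAdjoint_form_eOp K m m'
  have h2 := isSkewAdjoint_form_e'Op K m m'
  change form K (eOp K m) m' = form K m (-(eOp K m')) at h1
  change form K (e'Op K m) m' = form K m (-(e'Op K m')) at h2
  simp only [LinearMap.add_apply, LinearMap.smul_apply, map_add, map_smul, map_neg, smul_eq_mul, neg_add]
    at h1 h2 ⊢
  rw [h1, h2]
  ring

/-- **"This example was chosen as to make `𝔤` infinitesimally preserve a nondegenerate quadratic form on `M`":
`𝔤(𝔞, M) ≤ 𝔞𝔲𝔱(M, B)`** (A1-88: `h` and `𝔞` skew, `B` non-degenerate ⟹ the partners `f_a` and all of `𝔤(𝔞, M)` are skew).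
[cite: LooijengaLunts1997, §1 (1.1) Example, p0004 L51–L53] [cite: LooijengaLunts1997, §1 (1.3) p0005 L6–L9] -/
theorem lefschetzLieAlgebra_le_skewAdjointLieSubalgebra_form :
    lefschetzLieAlgebra K (hOp K) (𝔞 K) ≤ skewAdjointLieSubalgebra (form K) :=
  lefschetzLieAlgebra_le_skewAdjointLieSubalgebra (form_nondegenerate K) (isSkewAdjoint_form_hOp K)
    fun _ ha ↦ isSkewAdjoint_form_of_mem_𝔞 K ha

end NonReductiveExample

end Literature.Algebra.Lie
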